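import Mathlib
import Summits.QuantumFields.QCD.Theses.WilsonQuarkChessboard
import Literature.MathematicalPhysics.QuantumLattice.WilsonDiracAP
import Literature.Probability.LatticeModels.TorusFourierProofs
import Summits.QuantumFields.QCD.Theorems.WilsonQuarkChessboardFlatCellOptimalStubFreeTwistedFourierAuxAllN

/-!
# Torus-Fourier diagonalisation of the free twisted Wilson–Dirac operator, `N` colours
(helper for crux stmt-QuantumFields-9307 `FlatCellOptimal`, line `registered`, stub
`stub_hessianMarginAllN`, sub-goal `stub_freeTwistedFourierAllN` — the `Fin 3 ↦ Fin N` port of the sibling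
crux stmt-QuantumFields-9736's `…WilsonQuarkStabilityStubFreeTwistedFourier` (one common phase) and of the
plane-wave half of stmt-QuantumFields-9734's `…CriticalLineDiamagnetismStubFreeBlochBlocks`
(direction-dependent phases), gap G2a, wave 3)

What.  The FREE `r = 1` Wilson–Dirac operator `D = wilsonDirac ρ_N (fun e => w e.2) m 1` on `(ℤ/L)⁴`
(colour `Fin N`, ANY `N : ℕ`, spin `Fin 4`, bare mass `m`) whose link variable in direction `μ` is the
CONSTANT central phase `w μ = e^{iθ_μ}·1 ∈ U(N)` — the twisted free Bloch block `B⁰` of the one-loop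
analysis (`L = 2`, `θ_μ = π k_μ/M + π/(2M)`), and, for one common phase `θ_μ = θ₀ = π/L`, the free
antiperiodic operator in disguise.  Since `ρ(w μ) = e^{iθ_μ}·1`, `ρ((w μ)⁻¹) = e^{−iθ_μ}·1`
(`star_exp_smul_one`), `D` acts entrywise, colour-diagonally, as
`(Dψ)(x,a,α) = (m+4)ψ − ½ Σ_μ Σ_β [(1 − γ_μ)_{αβ} e^{iθ_μ} ψ(x+μ̂,a,β) + (1 + γ_μ)_{αβ} e^{−iθ_μ} ψ(x−μ̂,a,β)]`
(`wilsonDirac_dirTwist_mulVec_apply`); on a plane wave the two hops combine to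
`χ_k(x)(2 cos φ_μ − 2i sin φ_μ γ_μ)` at the SHIFTED angle `φ_μ = 2π k_μ.val / L + θ_μ`
(`twist_hop_planeWave`, colour-free, re-exported from the sibling), so
`D (χ_k ⊗ e_b ⊗ e_β) = χ_k ⊗ e_b ⊗ M(k) e_β` with the colour–spin symbol
`M(k) = (m + Σ_μ (1 − cos φ_μ))·1 + iΣ_μ sin φ_μ γ_μ` (`wilsonDirac_dirTwist_mulVec_planeWave`), i.e.
`D P = Q` for the unitary plane-wave matrix `P = F ⊗ 1_{N × 4}`, `F(x,k) = L⁻² χ_k(x)`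
(`wilsonDirac_dirTwist_mul_planeP`); the one-phase specialisations carry the sibling's names
(`wilsonDirac_twist_mulVec_apply`, `wilsonDirac_twist_mulVec_planeWave`, `wilsonDirac_twist_mul_planeP`).
With the Clifford identity `M(k)ᴴ M(k) = h(k)·1`, `h(k) = (m + Σ_μ (1 − cos φ_μ))² + Σ_μ sin² φ_μ`, the
colour-generic inversion of the auxiliary file gives (`stub_freeTwistedFourierAllN`):
`‖det D‖² = ∏_k h(k)^{4N}` (the only `N`-dependence: `4N` colour–spin components per momentum);
`c ≤ h ⇒ c Σ‖v‖² ≤ Σ‖Dv‖²`; and for `h > 0` on the grid `det D ≠ 0`,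
`(DᴴD)⁻¹((x,s),(y,s')) = δ_{ss'} L⁻⁴ Σ_k χ_k(x) conj χ_k(y) / h(k)` and
`D⁻¹((x,a,α),(y,b,β)) = δ_{ab} L⁻⁴ Σ_k χ_k(x) conj χ_k(y) (M(k)ᴴ)_{αβ} / h(k)`.

References: Montvay–Münster, *Quantum Fields on a Lattice* §4.2 (free Wilson fermions in momentum
space; twisted / antiperiodic boundary conditions as constant `U(1)` backgrounds); folklore.
Pure theorem file (no `def`s).
-/

namespace Summit.QuantumFields.QCD.Cruxes.FlatCellOptimal.FreeTwistedFourier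

open Literature.MathematicalPhysics Literature.MathematicalPhysics.QuantumLattice
  Literature.MathematicalPhysics.QuantumFieldTheory Literature.Probability.LatticeModels
open Matrix Complex
open scoped Kronecker ComplexOrder ComplexConjugate BigOperators

noncomputable section

/-! ### Colour-free plane-wave lemmas of the sibling file, re-exported

`e^{iθ₀} χ_k(e_μ) = cos φ_μ + i sin φ_μ`, `e^{−iθ₀} conj χ_k(e_μ) = cos φ_μ − i sin φ_μ` and the combined
hop `χ_k(x)(2 cos φ_μ δ_{αβ} − 2i sin φ_μ (γ_μ)_{αβ})`, `φ_μ = 2π k_μ.val / L + θ₀`: no colour index. -/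

export Summit.QuantumFields.QCD.Cruxes.WilsonQuarkStability.FreeTangentLandauChessboard
  (exp_mul_torusChar_single exp_neg_mul_conj_torusChar_single twist_hop_planeWave)

/-! ### The free Wilson–Dirac operator with constant central phases on plane waves -/

section Concrete

variable {N L : ℕ} [NeZero L]

/-- The adjoint (= inverse) of the constant central colour matrix `e^{iθ₀}·1` is `e^{−iθ₀}·1`
(any index type). -/
theorem star_exp_smul_one {n : Type*} [DecidableEq n] (θ₀ : ℝ) :
    star (Complex.exp (θ₀ * I) • (1 : Matrix n n ℂ)) = Complex.exp (-(θ₀ * I)) • (1 : Matrix n n ℂ) := by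
  rw [Matrix.star_eq_conjTranspose, conjTranspose_smul, conjTranspose_one, Complex.star_def,
    ← Complex.exp_conj, map_mul, Complex.conj_ofReal, Complex.conj_I, mul_neg]

/-- **Entrywise action of the free Wilson–Dirac operator with direction-dependent constant central
phases** (`U(x, μ) = w μ = e^{iθ_μ}·1 ∈ U(N)`, `r = 1`, mass `m`):
`(Dψ)(x,a,α) = (m+4)ψ(x,a,α) − ½ Σ_μ Σ_β [(1 − γ_μ)_{αβ} e^{iθ_μ} ψ(x+μ̂,a,β)
+ (1 + γ_μ)_{αβ} e^{−iθ_μ} ψ(x−μ̂,a,β)]` (colour-diagonal since `ρ(w μ) = e^{iθ_μ}·1`). -/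
theorem wilsonDirac_dirTwist_mulVec_apply (θ : Fin 4 → ℝ) (m : ℝ)
    (w : Fin 4 → Matrix.unitaryGroup (Fin N) ℂ)
    (hw : ∀ μ, (w μ : Matrix (Fin N) (Fin N) ℂ) = Complex.exp (θ μ * I) • (1 : Matrix (Fin N) (Fin N) ℂ))
    (ψ : TorusSite 4 L × Fin N × Fin 4 → ℂ) (x : TorusSite 4 L) (a : Fin N) (α : Fin 4) :
    (wilsonDirac (unitaryFundamentalRep (Fin N) ℂ) (fun e : Edge 4 L => w e.2) m 1 *ᵥ ψ) (x, a, α) =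
      ((m + 4 : ℝ) : ℂ) * ψ (x, a, α) - (1 / 2) * ∑ μ, ∑ β,
        ((1 - euclideanGamma μ) α β * Complex.exp (θ μ * I) * ψ (x + Pi.single μ 1, a, β) +
          (1 + euclideanGamma μ) α β * Complex.exp (-(θ μ * I)) * ψ (x - Pi.single μ 1, a, β)) := by
  have hf : ∀ μ : Fin 4, ∑ q : TorusSite 4 L × Fin N × Fin 4,
      (if q.1 = QuantumFieldTheory.Site.shift x μ then
          (1 - euclideanGamma μ) α q.2.2 *
            (Complex.exp (θ μ * I) • (1 : Matrix (Fin N) (Fin N) ℂ)) a q.2.1 else 0) * ψ q =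
        ∑ β, (1 - euclideanGamma μ) α β * Complex.exp (θ μ * I) * ψ (x + Pi.single μ 1, a, β) := by
    intro μ
    rw [Fintype.sum_prod_type, Finset.sum_eq_single (QuantumFieldTheory.Site.shift x μ)]
    · rw [Fintype.sum_prod_type, Finset.sum_eq_single a]
      · simp [QuantumFieldTheory.Site.shift]
      · intro b _ hb
        simp [Matrix.one_apply_ne (Ne.symm hb)]
      · simp
    · intro y _ hy
      simp [if_neg hy]
    · simp
  have hb : ∀ μ : Fin 4, ∑ q : TorusSite 4 L × Fin N × Fin 4,
      (if x = QuantumFieldTheory.Site.shift q.1 μ then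
          (1 + euclideanGamma μ) α q.2.2 *
            (Complex.exp (-(θ μ * I)) • (1 : Matrix (Fin N) (Fin N) ℂ)) a q.2.1 else 0) * ψ q =
        ∑ β, (1 + euclideanGamma μ) α β * Complex.exp (-(θ μ * I)) * ψ (x - Pi.single μ 1, a, β) := by
    intro μ
    simp_rw [eq_shift_iff]
    rw [Fintype.sum_prod_type, Finset.sum_eq_single (x - Pi.single μ 1)]
    · rw [Fintype.sum_prod_type, Finset.sum_eq_single a]
      · simp
      · intro b _ hb
        simp [Matrix.one_apply_ne (Ne.symm hb)]
      · simp
    · intro y _ hy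
      simp [if_neg hy]
    · simp
  simp only [mulVec, dotProduct, wilsonDirac, of_apply, unitaryFundamentalRep_apply,
    Matrix.UnitaryGroup.inv_val, hw, star_exp_smul_one, Complex.ofReal_one, one_smul, sub_mul,
    Finset.sum_sub_distrib]
  congr 1
  · rw [Finset.sum_eq_single (x, a, α)]
    · simp
    · intro q _ hq
      rw [if_neg (Ne.symm hq), zero_mul]
    · intro h; exact absurd (Finset.mem_univ _) h
  · simp_rw [Finset.mul_sum, Finset.sum_mul]
    rw [Finset.sum_comm]
    refine Finset.sum_congr rfl fun μ _ => ?_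
    simp_rw [mul_assoc, ← Finset.mul_sum]
    congr 1
    simp_rw [add_mul, Finset.sum_add_distrib, hf, hb, mul_assoc]

/-- **The free operator with direction-dependent phases on a plane wave** (colour `b`, spin `β`,
momentum `k`): `D (χ_k ⊗ e_b ⊗ e_β) = χ_k ⊗ e_b ⊗ M(k) e_β` with the colour–spin symbol
`M(k) = (m + Σ_μ (1 − cos φ_μ))·1 + i Σ_μ sin φ_μ γ_μ`, `φ_μ = 2π k_μ.val / L + θ_μ`. -/
theorem wilsonDirac_dirTwist_mulVec_planeWave (θ : Fin 4 → ℝ) (m : ℝ)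
    (w : Fin 4 → Matrix.unitaryGroup (Fin N) ℂ)
    (hw : ∀ μ, (w μ : Matrix (Fin N) (Fin N) ℂ) = Complex.exp (θ μ * I) • (1 : Matrix (Fin N) (Fin N) ℂ))
    (k : TorusSite 4 L) (b : Fin N) (β : Fin 4) :
    wilsonDirac (unitaryFundamentalRep (Fin N) ℂ) (fun e : Edge 4 L => w e.2) m 1 *ᵥ
        (fun l : TorusSite 4 L × Fin N × Fin 4 => torusChar k l.1 * if l.2 = (b, β) then 1 else 0) =
      fun p => torusChar k p.1 *
        if p.2.1 = b then
          ((((m + ∑ μ, (1 - Real.cos (2 * Real.pi * ((k μ).val : ℝ) / L + θ μ))) : ℝ) : ℂ) •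
              (1 : Matrix (Fin 4) (Fin 4) ℂ) +
            I • ∑ μ, ((Real.sin (2 * Real.pi * ((k μ).val : ℝ) / L + θ μ) : ℝ) : ℂ) • euclideanGamma μ)
            p.2.2 β
        else 0 := by
  funext p
  obtain ⟨x, a, α⟩ := p
  rw [wilsonDirac_dirTwist_mulVec_apply θ m w hw]
  dsimp only
  by_cases hab : a = b
  · subst hab
    simp only [Prod.mk.injEq, true_and, if_true, mul_ite, mul_one, mul_zero, Finset.sum_add_distrib,
      Finset.sum_ite_eq', Finset.mem_univ]
    rw [← Finset.sum_add_distrib, Finset.sum_congr rfl fun μ _ => twist_hop_planeWave (θ μ) k x μ α β]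
    simp only [Matrix.add_apply, Matrix.smul_apply, smul_eq_mul, Matrix.one_apply, Fin.sum_univ_four]
    push_cast
    split_ifs <;> ring
  · simp only [Prod.mk.injEq, hab, false_and, if_false, mul_zero, add_zero, Finset.sum_const_zero,
      sub_zero]

/-- **`D P = Q`**: on the plane-wave matrix `P = F ⊗ 1`, `F(x,k) = L⁻² χ_k(x)`, the free operator with
direction-dependent constant phases acts by the colour–spin symbol `1_N ⊗ M(k)`,
`M(k) = (m + Σ_μ (1 − cos φ_μ))·1 + i Σ_μ sin φ_μ γ_μ`, `φ_μ = 2π k_μ.val / L + θ_μ`. -/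
theorem wilsonDirac_dirTwist_mul_planeP (θ : Fin 4 → ℝ) (m : ℝ)
    (w : Fin 4 → Matrix.unitaryGroup (Fin N) ℂ)
    (hw : ∀ μ, (w μ : Matrix (Fin N) (Fin N) ℂ) = Complex.exp (θ μ * I) • (1 : Matrix (Fin N) (Fin N) ℂ)) :
    wilsonDirac (unitaryFundamentalRep (Fin N) ℂ) (fun e : Edge 4 L => w e.2) m 1 *
        ((Matrix.of fun x k : TorusSite 4 L => ((L : ℂ) ^ 2)⁻¹ * torusChar k x) ⊗ₖ
          (1 : Matrix (Fin N × Fin 4) (Fin N × Fin 4) ℂ)) =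
      Matrix.of fun p q : TorusSite 4 L × Fin N × Fin 4 =>
        (Matrix.of fun x k : TorusSite 4 L => ((L : ℂ) ^ 2)⁻¹ * torusChar k x) p.1 q.1 *
          ((1 : Matrix (Fin N) (Fin N) ℂ) ⊗ₖ
            ((((m + ∑ μ, (1 - Real.cos (2 * Real.pi * ((q.1 μ).val : ℝ) / L + θ μ))) : ℝ) : ℂ) •
                (1 : Matrix (Fin 4) (Fin 4) ℂ) +
              I • ∑ μ, ((Real.sin (2 * Real.pi * ((q.1 μ).val : ℝ) / L + θ μ) : ℝ) : ℂ) • euclideanGamma μ))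
            p.2 q.2 := by
  ext p q
  have hcol : (fun l : TorusSite 4 L × Fin N × Fin 4 =>
      ((Matrix.of fun x k : TorusSite 4 L => ((L : ℂ) ^ 2)⁻¹ * torusChar k x) ⊗ₖ
        (1 : Matrix (Fin N × Fin 4) (Fin N × Fin 4) ℂ)) l q) =
      ((L : ℂ) ^ 2)⁻¹ • fun l => torusChar q.1 l.1 * if l.2 = (q.2.1, q.2.2) then 1 else 0 := by
    funext l
    rw [Pi.smul_apply, smul_eq_mul, Matrix.kroneckerMap_apply, Matrix.of_apply, Matrix.one_apply,
      Prod.mk.eta, mul_assoc]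
  rw [Matrix.mul_apply', dotProduct, show (∑ l, wilsonDirac (unitaryFundamentalRep (Fin N) ℂ)
      (fun e : Edge 4 L => w e.2) m 1 p l *
      ((Matrix.of fun x k : TorusSite 4 L => ((L : ℂ) ^ 2)⁻¹ * torusChar k x) ⊗ₖ
        (1 : Matrix (Fin N × Fin 4) (Fin N × Fin 4) ℂ)) l q) =
      (wilsonDirac (unitaryFundamentalRep (Fin N) ℂ) (fun e : Edge 4 L => w e.2) m 1 *ᵥ fun l =>
        ((Matrix.of fun x k : TorusSite 4 L => ((L : ℂ) ^ 2)⁻¹ * torusChar k x) ⊗ₖ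
        (1 : Matrix (Fin N × Fin 4) (Fin N × Fin 4) ℂ)) l q) p from rfl,
    hcol, Matrix.mulVec_smul, Pi.smul_apply, wilsonDirac_dirTwist_mulVec_planeWave θ m w hw, smul_eq_mul,
    Matrix.of_apply, Matrix.of_apply, Matrix.kroneckerMap_apply, Matrix.one_apply, ite_mul, one_mul,
    zero_mul, mul_assoc]

/-! ### One common phase `ω = e^{iθ₀}·1` on every link (the sibling's operator) -/

/-- **Entrywise action of the free twisted Wilson–Dirac operator** (`U ≡ ω = e^{iθ₀}·1`, `r = 1`,
mass `m`): `(Dψ)(x,a,α) = (m+4)ψ(x,a,α) − ½ Σ_μ Σ_β [(1 − γ_μ)_{αβ} e^{iθ₀} ψ(x+μ̂,a,β)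
+ (1 + γ_μ)_{αβ} e^{−iθ₀} ψ(x−μ̂,a,β)]`. -/
theorem wilsonDirac_twist_mulVec_apply (θ₀ m : ℝ) (ω : Matrix.unitaryGroup (Fin N) ℂ)
    (hω : (ω : Matrix (Fin N) (Fin N) ℂ) = Complex.exp (θ₀ * I) • (1 : Matrix (Fin N) (Fin N) ℂ))
    (ψ : TorusSite 4 L × Fin N × Fin 4 → ℂ) (x : TorusSite 4 L) (a : Fin N) (α : Fin 4) :
    (wilsonDirac (unitaryFundamentalRep (Fin N) ℂ) (fun _ : Edge 4 L => ω) m 1 *ᵥ ψ) (x, a, α) =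
      ((m + 4 : ℝ) : ℂ) * ψ (x, a, α) - (1 / 2) * ∑ μ, ∑ β,
        ((1 - euclideanGamma μ) α β * Complex.exp (θ₀ * I) * ψ (x + Pi.single μ 1, a, β) +
          (1 + euclideanGamma μ) α β * Complex.exp (-(θ₀ * I)) * ψ (x - Pi.single μ 1, a, β)) :=
  wilsonDirac_dirTwist_mulVec_apply (fun _ => θ₀) m (fun _ => ω) (fun _ => hω) ψ x a α

/-- **The free twisted Wilson–Dirac operator on a plane wave** (colour `b`, spin `β`, momentum `k`):
`D (χ_k ⊗ e_b ⊗ e_β) = χ_k ⊗ e_b ⊗ M(k) e_β`, `M(k) = (m + Σ_μ (1 − cos φ_μ))·1 + i Σ_μ sin φ_μ γ_μ`,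
`φ_μ = 2π k_μ.val / L + θ₀`. -/
theorem wilsonDirac_twist_mulVec_planeWave (θ₀ m : ℝ) (ω : Matrix.unitaryGroup (Fin N) ℂ)
    (hω : (ω : Matrix (Fin N) (Fin N) ℂ) = Complex.exp (θ₀ * I) • (1 : Matrix (Fin N) (Fin N) ℂ))
    (k : TorusSite 4 L) (b : Fin N) (β : Fin 4) :
    wilsonDirac (unitaryFundamentalRep (Fin N) ℂ) (fun _ : Edge 4 L => ω) m 1 *ᵥ
        (fun l : TorusSite 4 L × Fin N × Fin 4 => torusChar k l.1 * if l.2 = (b, β) then 1 else 0) =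
      fun p => torusChar k p.1 *
        if p.2.1 = b then
          ((((m + ∑ μ, (1 - Real.cos (2 * Real.pi * ((k μ).val : ℝ) / L + θ₀))) : ℝ) : ℂ) •
              (1 : Matrix (Fin 4) (Fin 4) ℂ) +
            I • ∑ μ, ((Real.sin (2 * Real.pi * ((k μ).val : ℝ) / L + θ₀) : ℝ) : ℂ) • euclideanGamma μ)
            p.2.2 β
        else 0 :=
  wilsonDirac_dirTwist_mulVec_planeWave (fun _ => θ₀) m (fun _ => ω) (fun _ => hω) k b β

/-- **`D P = Q`** for one common phase: on the plane-wave matrix `P = F ⊗ 1`, `F(x,k) = L⁻² χ_k(x)`, the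
free twisted operator acts by the colour–spin symbol `1_N ⊗ M(k)`. -/
theorem wilsonDirac_twist_mul_planeP (θ₀ m : ℝ) (ω : Matrix.unitaryGroup (Fin N) ℂ)
    (hω : (ω : Matrix (Fin N) (Fin N) ℂ) = Complex.exp (θ₀ * I) • (1 : Matrix (Fin N) (Fin N) ℂ)) :
    wilsonDirac (unitaryFundamentalRep (Fin N) ℂ) (fun _ : Edge 4 L => ω) m 1 *
        ((Matrix.of fun x k : TorusSite 4 L => ((L : ℂ) ^ 2)⁻¹ * torusChar k x) ⊗ₖ
          (1 : Matrix (Fin N × Fin 4) (Fin N × Fin 4) ℂ)) =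
      Matrix.of fun p q : TorusSite 4 L × Fin N × Fin 4 =>
        (Matrix.of fun x k : TorusSite 4 L => ((L : ℂ) ^ 2)⁻¹ * torusChar k x) p.1 q.1 *
          ((1 : Matrix (Fin N) (Fin N) ℂ) ⊗ₖ
            ((((m + ∑ μ, (1 - Real.cos (2 * Real.pi * ((q.1 μ).val : ℝ) / L + θ₀))) : ℝ) : ℂ) •
                (1 : Matrix (Fin 4) (Fin 4) ℂ) +
              I • ∑ μ, ((Real.sin (2 * Real.pi * ((q.1 μ).val : ℝ) / L + θ₀) : ℝ) : ℂ) • euclideanGamma μ))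
            p.2 q.2 :=
  wilsonDirac_dirTwist_mul_planeP (fun _ => θ₀) m (fun _ => ω) (fun _ => hω)

end Concrete

/-- **Registered sub-goal `stub_freeTwistedFourierAllN`.**  Fourier diagonalisation of the free `r = 1`
Wilson–Dirac operator `D` of the CONSTANT central `U(N)` links `w μ = e^{iθ_μ}·1` on `(ℤ/L)⁴`, bare mass
`m`, every colour number `N`: with `φ_μ(k) = 2π k_μ.val / L + θ_μ`,
`h(k) = (m + Σ_μ (1 − cos φ_μ))² + Σ_μ sin² φ_μ` and `M(k) = (m + Σ_μ (1 − cos φ_μ))·1 + iΣ_μ sin φ_μ γ_μ`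
(the `let`s of the sibling statement as ∀-bound variables with defining equations):
`‖det D‖² = ∏_k h(k)^{4N}`; `c ≤ h ⇒ c Σ‖v‖² ≤ Σ‖Dv‖²`; and if `h > 0` on the momentum grid then
`det D ≠ 0`, `(DᴴD)⁻¹((x,s),(y,s')) = δ_{ss'} L⁻⁴ Σ_k χ_k(x) conj χ_k(y) / h(k)` and
`D⁻¹((x,a,α),(y,b,β)) = δ_{ab} L⁻⁴ Σ_k χ_k(x) conj χ_k(y) (M(k)ᴴ)_{αβ} / h(k)`. -/
theorem stub_freeTwistedFourierAllN : ∀ (N L : ℕ) [NeZero L] (θ : Fin 4 → ℝ) (m : ℝ) (w : Fin 4 → Matrix.unitaryGroup (Fin N) ℂ), (∀ μ, ((w μ : Matrix.unitaryGroup (Fin N) ℂ) : Matrix (Fin N) (Fin N) ℂ) = Complex.exp (θ μ * Complex.I) • (1 : Matrix (Fin N) (Fin N) ℂ)) → ∀ (φ : TorusSite 4 L → Fin 4 → ℝ) (h : TorusSite 4 L → ℝ) (M : TorusSite 4 L → Matrix (Fin 4) (Fin 4) ℂ) (D : Matrix (TorusSite 4 L × Fin N × Fin 4) (TorusSite 4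 L × Fin N × Fin 4) ℂ), (∀ k μ, φ k μ = 2 * Real.pi * ((k μ).val : ℝ) / L + θ μ) → (∀ k, h k = (m + ∑ μ, (1 - Real.cos (φ k μ))) ^ 2 + ∑ μ, Real.sin (φ k μ) ^ 2) → (∀ k, M k = (((m + ∑ μ, (1 - Real.cos (φ k μ)) : ℝ) : ℂ)) • (1 : Matrix (Fin 4) (Fin 4) ℂ) + Complex.I • ∑ μ, ((Real.sin (φ k μ) : ℝ) : ℂ) • euclideanGamma μ) → D = wilsonDirac (unitaryFundamentalRep (Fin N) ℂ) (fun e : Edge 4 L => w e.2) m 1 → ‖D.det‖ ^ 2 = ∏ k, h k ^ (4 * N) ∧ (∀ c : ℝ, (∀ k, c ≤ h k) → ∀ v : TorusSite 4 L × Fin N × Fin 4 → ℂ, c * ∑ i, ‖v i‖ ^ 2 ≤ ∑ i, ‖(D.mulVec v) i‖ ^ 2) ∧ ((∀ k, 0 < h k) → D.det ≠ 0 ∧ (∀ p q : TorusSite 4 L × Fin N × Fin 4, (Dᴴ * D)⁻¹ p q = if p.2 = q.2 then ((L : ℂ) ^ 4)⁻¹ * ∑ k, torusChar k p.1 * conj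 (torusChar k q.1) / ((h k : ℝ) : ℂ) else 0) ∧ (∀ p q : TorusSite 4 L × Fin N × Fin 4, D⁻¹ p q = if p.2.1 = q.2.1 then ((L : ℂ) ^ 4)⁻¹ * ∑ k, torusChar k p.1 * conj (torusChar k q.1) * (M k)ᴴ p.2.2 q.2.2 / ((h k : ℝ) : ℂ) else 0)) := by
  intro N L _ θ m w hw φ h M D hφ hh hM hD
  have eφ : φ = fun k μ => 2 * Real.pi * ((k μ).val : ℝ) / L + θ μ := funext fun k => funext (hφ k)
  subst eφ
  have eh : h = fun k => (m + ∑ μ, (1 - Real.cos (2 * Real.pi * ((k μ).val : ℝ) / L + θ μ))) ^ 2 +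
      ∑ μ, Real.sin (2 * Real.pi * ((k μ).val : ℝ) / L + θ μ) ^ 2 := funext hh
  subst eh
  have eM : M = fun k =>
      ((((m + ∑ μ, (1 - Real.cos (2 * Real.pi * ((k μ).val : ℝ) / L + θ μ))) : ℝ) : ℂ) •
          (1 : Matrix (Fin 4) (Fin 4) ℂ) +
        I • ∑ μ, ((Real.sin (2 * Real.pi * ((k μ).val : ℝ) / L + θ μ) : ℝ) : ℂ) • euclideanGamma μ) :=
    funext hM
  subst eM
  subst hD
  dsimp only
  have hS : ∀ k : TorusSite 4 L,
      ((((m + ∑ μ, (1 - Real.cos (2 * Real.pi * ((k μ).val : ℝ) / L + θ μ))) : ℝ) : ℂ) •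
            (1 : Matrix (Fin 4) (Fin 4) ℂ) +
          I • ∑ μ, ((Real.sin (2 * Real.pi * ((k μ).val : ℝ) / L + θ μ) : ℝ) : ℂ) • euclideanGamma μ)ᴴ *
        ((((m + ∑ μ, (1 - Real.cos (2 * Real.pi * ((k μ).val : ℝ) / L + θ μ))) : ℝ) : ℂ) •
            (1 : Matrix (Fin 4) (Fin 4) ℂ) +
          I • ∑ μ, ((Real.sin (2 * Real.pi * ((k μ).val : ℝ) / L + θ μ) : ℝ) : ℂ) • euclideanGamma μ) =
      (((m + ∑ μ, (1 - Real.cos (2 * Real.pi * ((k μ).val : ℝ) / L + θ μ))) ^ 2 +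
          ∑ μ, Real.sin (2 * Real.pi * ((k μ).val : ℝ) / L + θ μ) ^ 2 : ℝ) : ℂ) •
        (1 : Matrix (Fin 4) (Fin 4) ℂ) :=
    fun k => clifford_conjTranspose_mul_self _ _
  have hA := wilsonDirac_dirTwist_mul_planeP (L := L) θ m w hw
  refine ⟨?_, fun c hc v => coercive_of_planeWave _ _ hS _ hA c hc v, fun hpos => ?_⟩
  · have h1 := norm_sq_det_of_planeWave _ _ hS _ hA
    rwa [Fintype.card_fin] at h1
  · have hd0 : ∀ k : TorusSite 4 L,
        (m + ∑ μ, (1 - Real.cos (2 * Real.pi * ((k μ).val : ℝ) / L + θ μ))) ^ 2 +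
          ∑ μ, Real.sin (2 * Real.pi * ((k μ).val : ℝ) / L + θ μ) ^ 2 ≠ 0 := fun k => (hpos k).ne'
    exact ⟨det_ne_zero_of_planeWave _ _ hS hd0 _ hA, inv_gram_apply_of_planeWave _ _ hS hd0 _ hA,
      inv_apply_of_planeWave _ _ hS hd0 _ hA⟩

end

end Summit.QuantumFields.QCD.Cruxes.FlatCellOptimal.FreeTwistedFourier
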